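import Summits.CriticalPhenomena.CardyFormulaZ2.Theorems.CardyBondTriangularBondTriangularBoxCrossingDefs
import Literature.Probability.Percolation.StarTriangleMoves
import Literature.Probability.Percolation.BondTriangularThetaComparison
import Literature.Probability.LatticeModels.ProdBernoulliCoupling
import Literature.Probability.Percolation.PercolationEvents
import Literature.Probability.Percolation.PercolationProofs
import Literature.Probability.LatticeModels.IsoradialPercolationProofs
import Literature.Probability.Percolation.Crossings
import HarnessLib

/-!
# Route CardyBondTriangular — item `BondTriangularBoxCrossing`: the local moves

Support file (helper lemmas) for the unconditional proof of the route item
`BondTriangularBoxCrossing` (stmt-CriticalPhenomena-7023) along Grimmett–Manolescu's proof of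
their box-crossing theorem for general isoradial graphs (PTRF 159 (2014) = arXiv:1204.0505, §7),
specialised to the triangular lattice: the horizontal edges of `𝕋` between two fixed rows are
pushed out of a slab by a finite sequence of star–triangle transformations, after which the slab
is a region of an isoradial *square* lattice, for which the box-crossing property is a theorem of
the tree (`isoradialSquare_boxCrossing_lower_real`, GM14 Cor. 6.2).

This file provides the measure-theoretic bookkeeping of the individual moves, on top of
`Literature.Probability.Percolation.StarTriangleMoves` (`ConnEquiv`: two weight functions give the
same probability to every connective event):

* `conn A B` — the event that some vertex of `A` is joined to some vertex of `B` by an open path;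
  it is increasing, measurable, and connective when `A ∪ B` is protected
  (`ConnEquiv.real_conn_eq`, `real_conn_mono`);
* `connEquiv_doubleStep` — **the composite move of GM14 §7 on `𝕋`**: a triangle → star move at
  an up-triangle `{x, y, A}` with a spare isolated label `S` as centre, the star → triangle move at
  the former apex `A` (whose only other edges are its two upper edges `{A, u}`, `{A, w}` of the
  complementary weight), and the relabelling `S ↔ A`; net effect on the weights: `{x,y} : t ↦ 0`,
  `{x,A}, {y,A} : t ↦ 1 - t`, `{A,u}, {A,w} : 1 - t ↦ t`, `{u,w} : 0 ↦ t`;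
* `connEquiv_halfStep` — the same at the top row (`A` has no upper edges): triangle → star,
  removal of the pendant edge at `A`, relabelling; net effect `{x,y} : t ↦ 0`,
  `{x,A}, {y,A} : t ↦ 1 - t`;
* `real_conn_trunc_le_openCrossing` — restricting the weights to the pairs inside a vertex set `U`
  computes (a lower bound for) the probability of an open crossing *inside `U`*
  (`prodBernoulli_map_inter`).

## References

* G. R. Grimmett, I. Manolescu, PTRF 159 (2014), arXiv:1204.0505, §5.1–5.2 (star–triangle
  transformation, Fig. 5.2), §7 (proof of Thm 3.1 for general graphs).
* G. R. Grimmett, I. Manolescu, Ann. Probab. 41 (2013), arXiv:1105.5535, Prop. 2.2.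
-/

noncomputable section

namespace Summit.CriticalPhenomena.CardyFormulaZ2.Theorems.TriSweep

open MeasureTheory Literature.Probability.Percolation Literature.Probability.LatticeModels
open Literature.Probability.Percolation.StarTriangle

variable {V : Type*}

/-! ### The connection event between two vertex sets -/

/-- `conn A B` is increasing. -/
theorem isUpperSet_conn (A B : Set V) : IsUpperSet (conn A B) := by
  intro ω ω' h hω
  rw [mem_conn_iff] at hω ⊢
  obtain ⟨a, ha, b, hb, hab⟩ := hω
  exact ⟨a, ha, b, hb, isUpperSet_openConn a b h hab⟩

/-- `conn A B` is measurable (`V` countable). -/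
theorem measurableSet_conn [Countable V] (A B : Set V) : MeasurableSet (conn A B) :=
  MeasurableSet.biUnion (Set.to_countable A) fun a _ =>
    MeasurableSet.biUnion (Set.to_countable B) fun b _ => measurableSet_openConn_holds a b

/-- `conn A B` is connective as soon as `A` and `B` are protected. -/
theorem isConnective_conn {W : Set V} {E₀ : Set (Sym2 V)} {A B : Set V} (hA : A ⊆ W)
    (hB : B ⊆ W) : IsConnective W E₀ (conn A B) := by
  intro ω ω' h
  rw [mem_conn_iff, mem_conn_iff]
  refine exists_congr fun a => and_congr_right fun ha => exists_congr fun b =>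
    and_congr_right fun hb => ?_
  exact h.2 a (hA ha) b (hB hb)

/-- **Connectively equivalent weights give the same probability to `conn A B`** for protected
`A`, `B`. -/
theorem real_conn_eq_of_connEquiv [Countable V] {W : Set V} {E₀ : Set (Sym2 V)}
    {p q : Sym2 V → unitInterval} (h : ConnEquiv W E₀ p q) {A B : Set V} (hA : A ⊆ W)
    (hB : B ⊆ W) : (prodBernoulli p).real (conn A B) = (prodBernoulli q).real (conn A B) := by
  simp only [measureReal_def, h (measurableSet_conn A B) (isConnective_conn hA hB)]

/-- **Monotonicity**: larger weights give larger probability to `conn A B`. -/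
theorem real_conn_mono [Countable V] {p q : Sym2 V → unitInterval} (hpq : p ≤ q) (A B : Set V) :
    (prodBernoulli p).real (conn A B) ≤ (prodBernoulli q).real (conn A B) :=
  prodBernoulli_real_mono_of_isUpperSet hpq (isUpperSet_conn A B) (measurableSet_conn A B)

/-! ### Restriction of the weights to a vertex set -/

/-- A walk in the open graph of `F ∩ ω`, `F` = pairs inside `U`, starting in `U`, stays in `U` and
is open in `ω`. -/
theorem reachable_induce_of_reachable_inter {U : Set V} {ω : BondConfig V} {a b : V}
    (ha : a ∈ U) (h : (openGraph (pairsIn U ∩ ω)).Reachable a b) :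
    ω ∈ openConnIn U a b := by
  obtain ⟨w⟩ := h
  -- all vertices of `w` lie in `U`
  have hsupp : ∀ v ∈ w.support, v ∈ U := by
    intro v hv
    induction w with
    | nil => simp only [SimpleGraph.Walk.support_nil, List.mem_singleton] at hv; exact hv ▸ ha
    | @cons x y z hadj w' ih =>
      rw [SimpleGraph.Walk.support_cons, List.mem_cons] at hv
      have hy : y ∈ U := by
        have h1 := (openGraph_adj _ x y).1 hadj
        exact (mk_mem_pairsIn.1 h1.1.1).2
      rcases hv with rfl | hv
      · exact ha
      · exact ih hy hv
  -- transfer the walk to `openGraph ω`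
  have hedges : ∀ e ∈ w.edges, e ∈ (openGraph ω).edgeSet := by
    intro e he
    have he' := w.edges_subset_edgeSet he
    rw [openGraph, SimpleGraph.edgeSet_fromEdgeSet] at he' ⊢
    exact ⟨he'.1.2, he'.2⟩
  rw [mem_openConnIn_iff_exists_openWalk]
  refine ⟨w.transfer (openGraph ω) hedges, ?_⟩
  rw [SimpleGraph.Walk.support_transfer]
  exact hsupp

/-- **Restricted weights compute crossings inside `U`.** For `A ⊆ U`, the probability under the
restricted weights `truncW U p` that `A` is joined to `B` is at most the `P_p`-probability of an
open crossing from `A` to `B` *inside `U`* (in fact they are equal; only this inequality is used).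
-/
theorem real_conn_trunc_le_openCrossing [Countable V] (p : Sym2 V → unitInterval) {U A B : Set V}
    (hA : A ⊆ U) :
    (prodBernoulli (truncW U p)).real (conn A B) ≤ (prodBernoulli p).real (openCrossing U A B) := by
  classical
  set F : Set (Sym2 V) := pairsIn U with hF
  have hmeas_inter : Measurable fun ω : Set (Sym2 V) => F ∩ ω :=
    measurable_set_iff.2 fun j => by
      by_cases hj : j ∈ F
      · have : (fun ω : Set (Sym2 V) => j ∈ F ∩ ω) = fun ω => j ∈ ω := by
          funext ω; exact propext ⟨fun h => h.2, fun h => ⟨hj, h⟩⟩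
        rw [this]; exact measurable_set_mem j
      · have : (fun ω : Set (Sym2 V) => j ∈ F ∩ ω) = fun _ => False := by
          funext ω; exact propext ⟨fun h => hj h.1, False.elim⟩
        rw [this]; exact measurable_const
  have hlaw : (prodBernoulli p).map (fun ω => F ∩ ω) = prodBernoulli (truncW U p) := by
    rw [BondTri.prodBernoulli_map_inter]
    rfl
  have hmono : (fun ω => F ∩ ω) ⁻¹' conn A B ⊆ openCrossing U A B := by
    intro ω hω
    simp only [Set.mem_preimage, mem_conn_iff] at hω
    obtain ⟨a, haA, b, hbB, hab⟩ := hω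
    exact ⟨a, haA, b, hbB, reachable_induce_of_reachable_inter (hA haA) hab⟩
  calc (prodBernoulli (truncW U p)).real (conn A B)
      = ((prodBernoulli p).map (fun ω => F ∩ ω)).real (conn A B) := by rw [hlaw]
    _ = (prodBernoulli p).real ((fun ω => F ∩ ω) ⁻¹' conn A B) :=
        map_measureReal_apply hmeas_inter (measurableSet_conn A B)
    _ ≤ (prodBernoulli p).real (openCrossing U A B) := measureReal_mono hmono

/-! ### The composite moves -/

section Moves

variable [DecidableEq V] [Countable V] {W : Set V}

omit [DecidableEq V] [Countable V] in
/-- `κ_△(t, t, t) = 3t − t³ − 1`. -/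
theorem kappa_const (t : ℝ) : kappa (fun _ : Fin 3 => t) = 3 * t - t ^ 3 - 1 := by
  simp only [kappa]; ring

omit [DecidableEq V] [Countable V] in
/-- The corner map `![x, y, A]` is injective for distinct corners. -/
theorem injective_vec3 {x y A : V} (hxy : x ≠ y) (hxA : x ≠ A) (hyA : y ≠ A) :
    Function.Injective (![x, y, A] : Fin 3 → V) := by
  intro i j h
  fin_cases i <;> fin_cases j <;> simp_all [eq_comm]

omit [DecidableEq V] [Countable V] in
/-- The three triangle edges of the corners `![x, y, A]`. -/
theorem triEdge_vec3 (x y A : V) :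
    triEdge ![x, y, A] 0 = s(y, A) ∧ triEdge ![x, y, A] 1 = s(x, A) ∧ triEdge ![x, y, A] 2 = s(x, y) := by
  refine ⟨?_, ?_, ?_⟩ <;> simp [triEdge, fst3, snd3]

omit [DecidableEq V] [Countable V] in
/-- The three star edges at `S` of the corners `![x, y, A]`. -/
theorem starEdge_vec3 (x y A S : V) :
    starEdge ![x, y, A] S 0 = s(S, x) ∧ starEdge ![x, y, A] S 1 = s(S, y) ∧
      starEdge ![x, y, A] S 2 = s(S, A) := by
  refine ⟨?_, ?_, ?_⟩ <;> simp [starEdge]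

/-- **The triangle → star move alone** (GM13 Prop. 2.2; GM14 Fig. 5.2), in the form used here:
a triangle `{x, y, A}` with the constant weight `t`, `3t − t³ = 1`, `t < 1`, and an isolated spare
label `S ∉ W`; the weights `q` after the move have the triangle switched off and the three star
edges at `S` of weight `1 − t`, everything else unchanged. -/
theorem connEquiv_triToStar {p q : Sym2 V → unitInterval} {x y A S : V} (hxy : x ≠ y) (hxA : x ≠ A)
    (hyA : y ≠ A) (hxS : x ≠ S) (hyS : y ≠ S) (hAS : A ≠ S) (hS : S ∉ W) {t : unitInterval}
    (ht3 : 3 * (t : ℝ) - (t : ℝ) ^ 3 = 1) (ht1 : (t : ℝ) < 1)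
    (hxy_t : p s(x, y) = t) (hxA_t : p s(x, A) = t) (hyA_t : p s(y, A) = t)
    (hS0 : ∀ e, S ∈ e → p e = 0)
    (hq_xy : q s(x, y) = 0) (hq_xA : q s(x, A) = 0) (hq_yA : q s(y, A) = 0)
    (hq_Sx : q s(S, x) = unitInterval.symm t) (hq_Sy : q s(S, y) = unitInterval.symm t)
    (hq_SA : q s(S, A) = unitInterval.symm t)
    (hq_rest : ∀ e, e ≠ s(x, y) → e ≠ s(x, A) → e ≠ s(y, A) → e ≠ s(S, x) → e ≠ s(S, y) →
      e ≠ s(S, A) → q e = p e) :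
    ConnEquiv W (∅ : Set (Sym2 V)) p q := by
  have hv := injective_vec3 hxy hxA hyA
  have hvO : ∀ k, (![x, y, A] : Fin 3 → V) k ≠ S := by
    intro k; fin_cases k <;> simpa
  obtain ⟨t0, t1, t2⟩ := triEdge_vec3 x y A
  obtain ⟨s0, s1, s2⟩ := starEdge_vec3 x y A S
  have hpt : ∀ k, p (triEdge ![x, y, A] k) = t := by
    intro k; fin_cases k
    · exact t0 ▸ hyA_t
    · exact t1 ▸ hxA_t
    · exact t2 ▸ hxy_t
  have hq : q = afterMove p ![x, y, A] S := by
    funext e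
    by_cases h1 : ∃ k, e = triEdge ![x, y, A] k
    · obtain ⟨k, rfl⟩ := h1
      rw [afterMove_triEdge]
      fin_cases k
      · exact t0 ▸ hq_yA
      · exact t1 ▸ hq_xA
      · exact t2 ▸ hq_xy
    by_cases h2 : ∃ k, e = starEdge ![x, y, A] S k
    · obtain ⟨k, rfl⟩ := h2
      rw [afterMove_starEdge hv hvO, hpt]
      fin_cases k
      · exact s0 ▸ hq_Sx
      · exact s1 ▸ hq_Sy
      · exact s2 ▸ hq_SA
    push Not at h1 h2
    rw [afterMove_of_ne p h1 h2]
    refine hq_rest e ?_ ?_ ?_ ?_ ?_ ?_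
    · exact t2 ▸ h1 2
    · exact t1 ▸ h1 1
    · exact t0 ▸ h1 0
    · exact s0 ▸ h2 0
    · exact s1 ▸ h2 1
    · exact s2 ▸ h2 2
  rw [hq]
  refine connEquiv_afterMove hv hvO hS0 ?_ ?_ hS (fun e he => absurd he (Set.notMem_empty e))
  · have : (fun k => ((p (triEdge ![x, y, A] k) : unitInterval) : ℝ)) = fun _ => (t : ℝ) := by
      funext k; rw [hpt k]
    rw [this, kappa_const]; linarith
  · intro k; rw [hpt k]; exact ht1

omit [Countable V] in
/-- Relabelling by an involution fixing the protected vertices is a connective equivalence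
(`connEquiv_relabel`). -/
theorem connEquiv_comp_swap (p : Sym2 V → unitInterval) {S A : V} (hS : S ∉ W) (hA : A ∉ W) :
    ConnEquiv W (∅ : Set (Sym2 V)) p (fun e => p (Sym2.map (Equiv.swap S A) e)) := by
  refine connEquiv_relabel (Equiv.swap S A) (fun u hu => ?_) (fun e he => absurd he (Set.notMem_empty e))
    (fun e => ?_)
  · exact Equiv.swap_apply_of_ne_of_ne (fun h => hS (h ▸ hu)) (fun h => hA (h ▸ hu))
  · simp only [Sym2.map_map]
    have : ((Equiv.swap S A) ∘ (Equiv.swap S A) : V → V) = id := by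
      funext z; simp [Equiv.swap_apply_self]
    rw [this, Sym2.map_id, id]

omit [Countable V] in
/-- Extensionality on `Sym2 V` organised around two distinguished labels `S`, `A`. -/
theorem sym2_funext {β : Sort*} {f g : Sym2 V → β} (S A : V)
    (h1 : ∀ z, f s(S, z) = g s(S, z)) (h2 : ∀ z, z ≠ S → f s(A, z) = g s(A, z))
    (h3 : ∀ a b, a ≠ S → b ≠ S → a ≠ A → b ≠ A → f s(a, b) = g s(a, b)) : f = g := by
  funext e
  induction e using Sym2.ind with
  | h a b =>
    by_cases haS : a = S
    · subst haS; exact h1 b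
    by_cases hbS : b = S
    · subst hbS; rw [Sym2.eq_swap]; exact h1 a
    by_cases haA : a = A
    · subst haA; exact h2 b hbS
    by_cases hbA : b = A
    · subst hbA; rw [Sym2.eq_swap]; exact h2 a haS
    exact h3 a b haS hbS haA hbA

end Moves

end Summit.CriticalPhenomena.CardyFormulaZ2.Theorems.TriSweep

end
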